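import Summits.HodgeConjecture.HodgeConjecture.Theorems.F0P3cStCharTSShellFn        -- ★ p849538 «SHELL-FN★» (this seat): the (SHF′) target function, smooth characters of `M`
import Summits.HodgeConjecture.HodgeConjecture.Theorems.F0P3cStCharTSTorusDefs      -- ★ p849564 D1 «TORUS DEFS» (LH6-p01 g2): `torusTransform`, `hyperbolicSet`, `pairChar` (the named (TOR) terms)
import Literature.NumberTheory.Rogawski1990.LocalTransferFundamentalLemma           -- ★ `IsLocSmooth`
import HarnessLib

/-!
# F0 · P3c · line LH6 «StCharTS» — «SHF-RED★»: THE (SHF′) CONJUNCT OF THE (TOR) PACKAGE FOLLOWS FROM ONE SURJECTIVITY STATEMENT FOR THE TORUS TRANSFORM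
# [Rogawski1990, §12.7 L. 12.7.1 (proof) p. 191; L. 12.7.2 (proof) pp. 193–194 «there exists a function `f` such that `F_f(α) = φ(α) + φ(ᾱ⁻¹)`»]

Cell `pub/hodgecm-mathlib`, crux H413 = `stmt-HodgeConjecture-24833` (`--supports` lane, helper), route HCCMUnconditional; seat LH6-p05 (g2); KNOCK∕DEFAULT «SHF-RED★»
2026-09-02T05:47Z on desk F0P3b-plan (g23)'s (TOR) road (CENSUS-PSM v2 TERMS, ★ p849564).  THEOREMS ONLY, sorry-free, no definition ∕ instance ∕ notation ∕ named fact.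
OBJECTS (inline terms of record): `M := (UnitaryGroup.LocalRing L v)ˣ × ↥(normOneUnits (conjLocal L c v))`, `M_c` (★ p849333), `ω` (★ p849140), and BINDERS `Ftr`, `Ω`, `toC`
exactly as the (TOR) conjunct of ★ p849458 `F0P3cStCharTSSaHeadTorus.stSupportFiniteSqInt_of_carpet_torus` binds them (with its pin).
* **(SURJ)** — the ONE abstract target for the construction brick «SURJ★» (torsor `U∕T × T^{reg} → Ω` of «WEYL-HYP★» + the stage-(B) measure identity):
  «every `F : M → ℂ` that is smooth (`IsLocSmooth`: locally constant with compact support), `ω`-symmetric and VANISHES ON `M_c` is a torus transform: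
  `∃ φ, (IsLocSmooth φ ∧ tsupport φ ⊆ Ω) ∧ Ftr φ = F`».
* **`shf_of_surj`** — (SURJ) ⟹ the (SHF′) conjunct of ★ p849458 (tree `Theorems/F0P3cStCharTSSaHeadTorus.lean` :158–:159, VERBATIM by script): for every continuous pair `χ`,
  `j`, `m₀ ∉ M_c`, the W-symmetrised shell function `f_{η,m₀}` (`η = toC (cond j (wχ) χ)`) is smooth (★ p849538 `isLocallyConstant_shellFn` ∕ `hasCompactSupport_shellFn`),
  `ω`-symmetric (★ `shellFn_reflect`) and vanishes on `M_c` (`shellFn_apply_of_mem_torusCompactPart` below: `m₀M_c` and `ω(m₀M_c)` miss `M_c` when `m₀ ∉ M_c`), and `η` is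
  continuous by the pin (`continuous_toC_of_pin`); so (SURJ) applies.
* **`shf_of_surj_torusTransform`** — the same at the NAMED terms `torusTransform L v mQv μM` ∕ `hyperbolicSet L v` ∕ `pairChar L v` of ★ p849564 (pin = ★ `pairChar_apply`).
* helpers: `isLocSmooth_shellFn`, `smul_torusCompactPart_disjoint_torusCompactPart` ∕ `shellFn_apply_of_mem_torusCompactPart` (vanishing on `M_c`), `continuous_conjInvChar`,
  `continuous_toC_of_pin`.
HONEST LABEL: HC_CM is proved only modulo the 7 printed citations (2 remaining: hLiu418 = stmt-HodgeConjecture-24832, h413 = stmt-HodgeConjecture-24833) until rung 0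
closes; count-neutral (a reduction; (SURJ) itself — Harish-Chandra's surjectivity of `f ↦ F_f` onto the `W`-invariant smooth functions on the regular set, in the form
print uses on p. 194 — is NOT proved here).

## References
* [Rogawski1990] J. D. Rogawski, *Automorphic Representations of Unitary Groups in Three Variables*, Ann. of Math. Stud. 123 (1990): §12.7 L. 12.7.1 (proof) p. 191,
  L. 12.7.2 (proof) pp. 193–194; §12.2 p. 173.
* [HarishChandra1970] Harish-Chandra (notes by G. van Dijk), *Harmonic Analysis on Reductive p-adic Groups*, LNM 162 (1970), §§3–5 (the map `f ↦ F_f`).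
-/

set_option autoImplicit false
-- the mandated namespace has the single-problem summit's repeated segment (`HodgeConjecture.HodgeConjecture`)
set_option linter.dupNamespace false

noncomputable section

open NumberField IsDedekindDomain MeasureTheory Measure Topology Filter
open scoped NNReal ENNReal Pointwise
open Literature.NumberTheory.Rogawski1990 Literature.NumberTheory.Automorphic Literature.NumberTheory.Automorphic.UnitaryGroup

namespace Summit.HodgeConjecture.HodgeConjecture.Cruxes.H413.F0P3cStCharTSShfOfSurj

variable (L : Type) [Field L] [NumberField L] [IsCMField L] (v : HeightOneSpectrum (𝓞 ↥(maximalRealSubfield L)))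

/-! ## §1 Helpers: smoothness of the shell function, vanishing on `M_c`, continuity of the pair characters -/

/-- **`f_{η,m₀}` is smooth on `M`** (`IsLocSmooth` = locally constant + compact support; ★ p849538). Non-split `v`. [cite: Rogawski1990, §12.7 L. 12.7.2 (proof) p. 194] -/
theorem isLocSmooth_shellFn (hns : ∀ w : PlacesOver L v, IsCMField.complexConj L • w.1 = w.1) (η : ((UnitaryGroup.LocalRing L v)ˣ × ↥(normOneUnits (conjLocal L (IsCMField.complexConj L) v))) →* ℂˣ) (hη : Continuous η) (m₀ : ((UnitaryGroup.LocalRing L v)ˣ × ↥(normOneUnits (conjLocal L (IsCMField.complexConj L) v)))) :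
    IsLocSmooth (fun m : ((UnitaryGroup.LocalRing L v)ˣ × ↥(normOneUnits (conjLocal L (IsCMField.complexConj L) v))) => (m₀ • ((((Submonoid.pi Set.univ (fun w : PlacesOver L v => (w.1.adicCompletionIntegers L).toSubring.toSubmonoid)).units.prod (⊤ : Subgroup ↥(normOneUnits (conjLocal L (IsCMField.complexConj L) v)))) : Subgroup ((UnitaryGroup.LocalRing L v)ˣ × ↥(normOneUnits (conjLocal L (IsCMField.complexConj L) v)))) : Set ((UnitaryGroup.LocalRing L v)ˣ × ↥(normOneUnits (conjLocal L (IsCMField.complexConj L) v))))).indicator (fun m : ((UnitaryGroup.LocalRing L v)ˣ × ↥(normOneUnits (conjLocal L (IsCMField.complexConj L) v))) => ((η m₀ : ℂˣ) : ℂ) * (((η m)⁻¹ : ℂˣ) : ℂ)) m + (m₀ • ((((Submonoid.pi Set.univ (fun w : PlacesOver L v => (w.1.adicCompletionIntegers L).toSubring.toSubmonoid)).units.prod (⊤ : Subgroup ↥(normOneUnits (conjLocal L (IsCMField.complexConj L) v)))) : Subgroup ((UnitaryGroup.LocalRing L v)ˣ × ↥(normOneUnits (conjLocal L (IsCMField.complexConj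 L) v)))) : Set ((UnitaryGroup.LocalRing L v)ˣ × ↥(normOneUnits (conjLocal L (IsCMField.complexConj L) v))))).indicator (fun m : ((UnitaryGroup.LocalRing L v)ˣ × ↥(normOneUnits (conjLocal L (IsCMField.complexConj L) v))) => ((η m₀ : ℂˣ) : ℂ) * (((η m)⁻¹ : ℂˣ) : ℂ)) ((Units.map ((conjLocal L (IsCMField.complexConj L) v : UnitaryGroup.LocalRing L v →+* UnitaryGroup.LocalRing L v) : UnitaryGroup.LocalRing L v →* UnitaryGroup.LocalRing L v) m.1)⁻¹, m.2)) :=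
  ⟨F0P3cStCharTSShellFn.isLocallyConstant_shellFn L v η hη m₀, F0P3cStCharTSShellFn.hasCompactSupport_shellFn L v hns η m₀⟩

/-- A non-unit shell misses the unit shell: `m₀ ∉ M_c ⇒ m₀M_c ∩ M_c = ∅` (cosets of a subgroup). Any finite `v`. [cite: Rogawski1990, §12.7 L. 12.7.1 (proof) p. 191] -/
theorem notMem_smul_of_mem_torusCompactPart {m₀ m : ((UnitaryGroup.LocalRing L v)ˣ × ↥(normOneUnits (conjLocal L (IsCMField.complexConj L) v)))} (hm₀ : m₀ ∉ (((Submonoid.pi Set.univ (fun w : PlacesOver L v => (w.1.adicCompletionIntegers L).toSubring.toSubmonoid)).units.prod (⊤ : Subgroup ↥(normOneUnits (conjLocal L (IsCMField.complexConj L) v)))) : Subgroup ((UnitaryGroup.LocalRing L v)ˣ × ↥(normOneUnits (conjLocal L (IsCMField.complexConj L) v))))) (hm : m ∈ (((Submonoid.pi Set.univ (fun w : PlacesOver L v => (w.1.adicCompletionIntegers L).toSubring.toSubmonoid)).units.prod (⊤ : Subgroup ↥(normOneUnits (conjLocal L (IsCMField.complexConj L) v)))) : Subgroup ((UnitaryGroup.LocalRing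 L v)ˣ × ↥(normOneUnits (conjLocal L (IsCMField.complexConj L) v))))) :
    m ∉ m₀ • ((((Submonoid.pi Set.univ (fun w : PlacesOver L v => (w.1.adicCompletionIntegers L).toSubring.toSubmonoid)).units.prod (⊤ : Subgroup ↥(normOneUnits (conjLocal L (IsCMField.complexConj L) v)))) : Subgroup ((UnitaryGroup.LocalRing L v)ˣ × ↥(normOneUnits (conjLocal L (IsCMField.complexConj L) v)))) : Set ((UnitaryGroup.LocalRing L v)ˣ × ↥(normOneUnits (conjLocal L (IsCMField.complexConj L) v)))) := by
  rintro ⟨u, hu, hum⟩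
  refine hm₀ ?_
  have h : m₀ = m * u⁻¹ := by
    rw [← hum]
    simp only [smul_eq_mul, mul_inv_cancel_right]
  rw [h]
  exact Subgroup.mul_mem _ hm (Subgroup.inv_mem _ hu)

/-- **`f_{η,m₀}` VANISHES ON `M_c`** when `m₀ ∉ M_c` (non-split `v`): `M_c` misses `m₀M_c`, and misses `ω(m₀M_c)` because `ω(M_c) ⊆ M_c` (★ `reflect_mem_torusCompactPart`).
[cite: Rogawski1990, §12.7 L. 12.7.1 (proof) p. 191] -/
theorem shellFn_apply_of_mem_torusCompactPart (hns : ∀ w : PlacesOver L v, IsCMField.complexConj L • w.1 = w.1) (η : ((UnitaryGroup.LocalRing L v)ˣ × ↥(normOneUnits (conjLocal L (IsCMField.complexConj L) v))) →* ℂˣ) {m₀ : ((UnitaryGroup.LocalRing L v)ˣ × ↥(normOneUnits (conjLocal L (IsCMField.complexConj L) v)))}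
    (hm₀ : m₀ ∉ (((Submonoid.pi Set.univ (fun w : PlacesOver L v => (w.1.adicCompletionIntegers L).toSubring.toSubmonoid)).units.prod (⊤ : Subgroup ↥(normOneUnits (conjLocal L (IsCMField.complexConj L) v)))) : Subgroup ((UnitaryGroup.LocalRing L v)ˣ × ↥(normOneUnits (conjLocal L (IsCMField.complexConj L) v))))) {m : ((UnitaryGroup.LocalRing L v)ˣ × ↥(normOneUnits (conjLocal L (IsCMField.complexConj L) v)))} (hm : m ∈ (((Submonoid.pi Set.univ (fun w : PlacesOver L v => (w.1.adicCompletionIntegers L).toSubring.toSubmonoid)).units.prod (⊤ : Subgroup ↥(normOneUnits (conjLocal L (IsCMField.complexConj L) v)))) : Subgroup ((UnitaryGroup.LocalRing L v)ˣ × ↥(normOneUnits (conjLocal L (IsCMField.complexConj L) v))))) : (fun m : ((UnitaryGroup.LocalRing L v)ˣ × ↥(normOneUnits (conjLocal L (IsCMField.complexConj L) v))) => (m₀ • ((((Submonoid.pi Set.univ (fun w : PlacesOver L v => (w.1.adicCompletionIntegers L).toSubring.toSubmonoid)).units.prod (⊤ : Subgroup ↥(normOneUnits (conjLocal L (IsCMField.complexConj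 L) v)))) : Subgroup ((UnitaryGroup.LocalRing L v)ˣ × ↥(normOneUnits (conjLocal L (IsCMField.complexConj L) v)))) : Set ((UnitaryGroup.LocalRing L v)ˣ × ↥(normOneUnits (conjLocal L (IsCMField.complexConj L) v))))).indicator (fun m : ((UnitaryGroup.LocalRing L v)ˣ × ↥(normOneUnits (conjLocal L (IsCMField.complexConj L) v))) => ((η m₀ : ℂˣ) : ℂ) * (((η m)⁻¹ : ℂˣ) : ℂ)) m + (m₀ • ((((Submonoid.pi Set.univ (fun w : PlacesOver L v => (w.1.adicCompletionIntegers L).toSubring.toSubmonoid)).units.prod (⊤ : Subgroup ↥(normOneUnits (conjLocal L (IsCMField.complexConj L) v)))) : Subgroup ((UnitaryGroup.LocalRing L v)ˣ × ↥(normOneUnits (conjLocal L (IsCMField.complexConj L) v)))) : Set ((UnitaryGroup.LocalRing L v)ˣ × ↥(normOneUnits (conjLocal L (IsCMField.complexConj L) v))))).indicator (fun m : ((UnitaryGroup.LocalRing L v)ˣ × ↥(normOneUnits (conjLocal L (IsCMField.complexConj L) v))) => ((η m₀ : ℂˣ) : ℂ) * (((η m)⁻¹ : ℂˣ) : ℂ))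 ((Units.map ((conjLocal L (IsCMField.complexConj L) v : UnitaryGroup.LocalRing L v →+* UnitaryGroup.LocalRing L v) : UnitaryGroup.LocalRing L v →* UnitaryGroup.LocalRing L v) m.1)⁻¹, m.2)) m = 0 := by
  refine F0P3cStCharTSShellFn.shellFn_apply_of_not_mem L v η ?_
  rintro (h | h)
  · exact notMem_smul_of_mem_torusCompactPart L v hm₀ hm h
  · rw [F0P3cStCharTSShellFn.image_reflect_eq_preimage] at h
    exact notMem_smul_of_mem_torusCompactPart L v hm₀ (F0P3cStCharTSTorusCompactPart.reflect_mem_torusCompactPart L v hns m hm) h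

omit [IsCMField L] in
/-- `χ̄₁⁻¹ = (χ₁ ∘ σ)⁻¹` is continuous when `χ₁` is (★ `continuous_conjLocal`). [cite: Rogawski1990, §12.2 p. 173] -/
theorem continuous_conjInvChar (c : L ≃ₐ[↥(maximalRealSubfield L)] L) (χ₁ : (UnitaryGroup.LocalRing L v)ˣ →* ℂˣ) (hχ₁ : Continuous χ₁) :
    Continuous (conjInvChar (conjLocal L c v) χ₁) := by
  have h : ⇑(conjInvChar (conjLocal L c v) χ₁) = fun x => (χ₁ (Units.map ((conjLocal L c v : UnitaryGroup.LocalRing L v →+* UnitaryGroup.LocalRing L v) :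
      UnitaryGroup.LocalRing L v →* UnitaryGroup.LocalRing L v) x))⁻¹ := funext fun x => conjInvChar_apply _ χ₁ x
  rw [h]
  exact (hχ₁.comp (Continuous.units_map _ (continuous_conjLocal L c v))).inv

/-- The pinned pair character `toC χ = χ₁∘fst · χ₂∘snd` is continuous when `χ₁`, `χ₂` are. [cite: Rogawski1990, §12.1 p. 171] -/
theorem continuous_toC_of_pin (toC : (((UnitaryGroup.LocalRing L v)ˣ →* ℂˣ) × (↥(normOneUnits (conjLocal L (IsCMField.complexConj L) v)) →* ℂˣ)) → (((UnitaryGroup.LocalRing L v)ˣ × ↥(normOneUnits (conjLocal L (IsCMField.complexConj L) v))) →* ℂˣ)) (htoC : (∀ (χ : (((UnitaryGroup.LocalRing L v)ˣ →* ℂˣ) × (↥(normOneUnits (conjLocal L (IsCMField.complexConj L) v)) →* ℂˣ))) (m : ((UnitaryGroup.LocalRing L v)ˣ × ↥(normOneUnits (conjLocal L (IsCMField.complexConj L) v)))), toC χ m = χ.1 m.1 * χ.2 m.2)) (χ : (((UnitaryGroup.LocalRing L v)ˣ →* ℂˣ) × (↥(normOneUnits (conjLocal L (IsCMField.complexConj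 L) v)) →* ℂˣ))) (hχ₁ : Continuous χ.1) (hχ₂ : Continuous χ.2) :
    Continuous (toC χ) := by
  have h : ⇑(toC χ) = fun m : ((UnitaryGroup.LocalRing L v)ˣ × ↥(normOneUnits (conjLocal L (IsCMField.complexConj L) v))) => χ.1 m.1 * χ.2 m.2 := funext fun m => htoC χ m
  rw [h]
  exact (hχ₁.comp continuous_fst).mul (hχ₂.comp continuous_snd)

/-! ## §2 (SHF′) from (SURJ) -/

/-- **«SHF-RED★»: (SURJ) ⟹ (SHF′).**  For ANY torus transform `Ftr`, hyperbolic set `Ω` and pinned pair characters `toC` (the binders of the (TOR) conjunct of ★ p849458),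
if every smooth `ω`-symmetric `F : M → ℂ` vanishing on `M_c` is `Ftr φ` for some smooth `φ` supported in `Ω` (SURJ), then the (SHF′) conjunct holds (its text VERBATIM):
the W-symmetrised `η`-isotypic shell functions on the non-unit shells are torus transforms of hyperbolic test functions.  Non-split `v`.
[cite: Rogawski1990, §12.7 L. 12.7.1 (proof) p. 191; L. 12.7.2 (proof) pp. 193–194] -/
theorem shf_of_surj (hns : ∀ w : PlacesOver L v, IsCMField.complexConj L • w.1 = w.1)
    (Ftr : (Gqs L v → ℂ) → ((UnitaryGroup.LocalRing L v)ˣ × ↥(normOneUnits (conjLocal L (IsCMField.complexConj L) v))) → ℂ) (Ω : Set (Gqs L v)) (toC : (((UnitaryGroup.LocalRing L v)ˣ →* ℂˣ) × (↥(normOneUnits (conjLocal L (IsCMField.complexConj L) v)) →* ℂˣ)) → (((UnitaryGroup.LocalRing L v)ˣ × ↥(normOneUnits (conjLocal L (IsCMField.complexConj L) v))) →* ℂˣ)) (htoC : (∀ (χ : (((UnitaryGroup.LocalRing L v)ˣ →* ℂˣ) × (↥(normOneUnits (conjLocal L (IsCMField.complexConj L) v)) →* ℂˣ))) (m : ((UnitaryGroup.LocalRing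 L v)ˣ × ↥(normOneUnits (conjLocal L (IsCMField.complexConj L) v)))), toC χ m = χ.1 m.1 * χ.2 m.2))
    (hsurj : ∀ F : ((UnitaryGroup.LocalRing L v)ˣ × ↥(normOneUnits (conjLocal L (IsCMField.complexConj L) v))) → ℂ, IsLocSmooth F → (∀ m : ((UnitaryGroup.LocalRing L v)ˣ × ↥(normOneUnits (conjLocal L (IsCMField.complexConj L) v))), F ((fun p : ((UnitaryGroup.LocalRing L v)ˣ × ↥(normOneUnits (conjLocal L (IsCMField.complexConj L) v))) => ((Units.map ((conjLocal L (IsCMField.complexConj L) v : UnitaryGroup.LocalRing L v →+* UnitaryGroup.LocalRing L v) : UnitaryGroup.LocalRing L v →* UnitaryGroup.LocalRing L v) p.1)⁻¹, p.2)) m) = F m) → (∀ m ∈ (((Submonoid.pi Set.univ (fun w : PlacesOver L v => (w.1.adicCompletionIntegers L).toSubring.toSubmonoid)).units.prod (⊤ : Subgroup ↥(normOneUnits (conjLocal L (IsCMField.complexConj L) v)))) : Subgroup ((UnitaryGroup.LocalRing L v)ˣ × ↥(normOneUnits (conjLocal L (IsCMField.complexConj L) v)))), F m = 0) →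
      ∃ φ : Gqs L v → ℂ, (IsLocSmooth φ ∧ tsupport φ ⊆ Ω) ∧ Ftr φ = F) :
    (∀ χ : (((UnitaryGroup.LocalRing L v)ˣ →* ℂˣ) × (↥(normOneUnits (conjLocal L (IsCMField.complexConj L) v)) →* ℂˣ)), Continuous χ.1 → Continuous χ.2 → ∀ (j : Bool) (m₀ : ((UnitaryGroup.LocalRing L v)ˣ × ↥(normOneUnits (conjLocal L (IsCMField.complexConj L) v)))), m₀ ∉ ((Submonoid.pi Set.univ (fun w : PlacesOver L v => (w.1.adicCompletionIntegers L).toSubring.toSubmonoid)).units.prod (⊤ : Subgroup ↥(normOneUnits (conjLocal L (IsCMField.complexConj L) v)))) → ∃ φ : Gqs L v → ℂ, (IsLocSmooth φ ∧ tsupport φ ⊆ Ω) ∧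
            Ftr φ = fun m => ((m₀ • ((((Submonoid.pi Set.univ (fun w : PlacesOver L v => (w.1.adicCompletionIntegers L).toSubring.toSubmonoid)).units.prod (⊤ : Subgroup ↥(normOneUnits (conjLocal L (IsCMField.complexConj L) v)))) : Subgroup ((UnitaryGroup.LocalRing L v)ˣ × ↥(normOneUnits (conjLocal L (IsCMField.complexConj L) v)))) : Set ((UnitaryGroup.LocalRing L v)ˣ × ↥(normOneUnits (conjLocal L (IsCMField.complexConj L) v))))).indicator (fun m => (((toC (cond j (conjInvChar (conjLocal L (IsCMField.complexConj L) v) χ.1, χ.2) χ)) m₀ : ℂˣ) : ℂ) * ((((toC (cond j (conjInvChar (conjLocal L (IsCMField.complexConj L) v) χ.1, χ.2) χ)) m)⁻¹ : ℂˣ) : ℂ)) m) + ((m₀ • ((((Submonoid.pi Set.univ (fun w : PlacesOver L v => (w.1.adicCompletionIntegers L).toSubring.toSubmonoid)).units.prod (⊤ : Subgroup ↥(normOneUnits (conjLocal L (IsCMField.complexConj L) v)))) : Subgroup ((UnitaryGroup.LocalRing L v)ˣ × ↥(normOneUnits (conjLocal L (IsCMField.complexConj L) v)))) : Set ((UnitaryGroup.LocalRing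 L v)ˣ × ↥(normOneUnits (conjLocal L (IsCMField.complexConj L) v))))).indicator (fun m => (((toC (cond j (conjInvChar (conjLocal L (IsCMField.complexConj L) v) χ.1, χ.2) χ)) m₀ : ℂˣ) : ℂ) * ((((toC (cond j (conjInvChar (conjLocal L (IsCMField.complexConj L) v) χ.1, χ.2) χ)) m)⁻¹ : ℂˣ) : ℂ)) ((Units.map ((conjLocal L (IsCMField.complexConj L) v : UnitaryGroup.LocalRing L v →+* UnitaryGroup.LocalRing L v) : UnitaryGroup.LocalRing L v →* UnitaryGroup.LocalRing L v) m.1)⁻¹, m.2))) := by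
  intro χ hχ₁ hχ₂ j m₀ hm₀
  have hη : Continuous (toC (cond j (conjInvChar (conjLocal L (IsCMField.complexConj L) v) χ.1, χ.2) χ)) := by
    cases j
    · exact continuous_toC_of_pin L v toC htoC χ hχ₁ hχ₂
    · exact continuous_toC_of_pin L v toC htoC _ (continuous_conjInvChar L v (IsCMField.complexConj L) χ.1 hχ₁) hχ₂
  exact hsurj _ (isLocSmooth_shellFn L v hns _ hη m₀) (F0P3cStCharTSShellFn.shellFn_reflect L v _ m₀)
    (fun m hm => shellFn_apply_of_mem_torusCompactPart L v hns _ hm₀ hm)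

/-- **(SURJ) ⟹ (SHF′) at the NAMED terms of ★ p849564**: `Ftr := torusTransform L v mQv μM` (van Dijk's normalised orbital transform, calibrated by `(2 μM(M_c))⁻¹`),
`Ω := hyperbolicSet L v`, `toC := pairChar L v` (pin ★ `pairChar_apply`). [cite: Rogawski1990, §12.7 L. 12.7.2 (proof) pp. 193–194] -/
theorem shf_of_surj_torusTransform (hns : ∀ w : PlacesOver L v, IsCMField.complexConj L • w.1 = w.1)
    [MeasurableSpace (Gqs L v)] [∀ γ : Gqs L v, MeasurableSpace (Gqs L v ⧸ Subgroup.centralizer ({γ} : Set (Gqs L v)))]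
    (mQv : OrbitalMeasureFamily (Gqs L v)) [MeasurableSpace ((UnitaryGroup.LocalRing L v)ˣ × ↥(normOneUnits (conjLocal L (IsCMField.complexConj L) v)))] (μM : Measure ((UnitaryGroup.LocalRing L v)ˣ × ↥(normOneUnits (conjLocal L (IsCMField.complexConj L) v))))
    (hsurj : ∀ F : ((UnitaryGroup.LocalRing L v)ˣ × ↥(normOneUnits (conjLocal L (IsCMField.complexConj L) v))) → ℂ, IsLocSmooth F → (∀ m : ((UnitaryGroup.LocalRing L v)ˣ × ↥(normOneUnits (conjLocal L (IsCMField.complexConj L) v))), F ((fun p : ((UnitaryGroup.LocalRing L v)ˣ × ↥(normOneUnits (conjLocal L (IsCMField.complexConj L) v))) => ((Units.map ((conjLocal L (IsCMField.complexConj L) v : UnitaryGroup.LocalRing L v →+* UnitaryGroup.LocalRing L v) : UnitaryGroup.LocalRing L v →* UnitaryGroup.LocalRing L v) p.1)⁻¹, p.2)) m) = F m) → (∀ m ∈ (((Submonoid.pi Set.univ (fun w : PlacesOver L v => (w.1.adicCompletionIntegers L).toSubring.toSubmonoid)).units.prod (⊤ : Subgroup ↥(normOneUnits (conjLocal L (IsCMField.complexConj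 L) v)))) : Subgroup ((UnitaryGroup.LocalRing L v)ˣ × ↥(normOneUnits (conjLocal L (IsCMField.complexConj L) v)))), F m = 0) →
      ∃ φ : Gqs L v → ℂ, (IsLocSmooth φ ∧ tsupport φ ⊆ F0P3cStCharTSTorusDefs.hyperbolicSet L v) ∧ F0P3cStCharTSTorusDefs.torusTransform L v mQv μM φ = F) :
    (∀ χ : (((UnitaryGroup.LocalRing L v)ˣ →* ℂˣ) × (↥(normOneUnits (conjLocal L (IsCMField.complexConj L) v)) →* ℂˣ)), Continuous χ.1 → Continuous χ.2 → ∀ (j : Bool) (m₀ : ((UnitaryGroup.LocalRing L v)ˣ × ↥(normOneUnits (conjLocal L (IsCMField.complexConj L) v)))), m₀ ∉ ((Submonoid.pi Set.univ (fun w : PlacesOver L v => (w.1.adicCompletionIntegers L).toSubring.toSubmonoid)).units.prod (⊤ : Subgroup ↥(normOneUnits (conjLocal L (IsCMField.complexConj L) v)))) → ∃ φ : Gqs L v → ℂ, (IsLocSmooth φ ∧ tsupport φ ⊆ F0P3cStCharTSTorusDefs.hyperbolicSet L v) ∧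
            F0P3cStCharTSTorusDefs.torusTransform L v mQv μM φ = fun m => ((m₀ • ((((Submonoid.pi Set.univ (fun w : PlacesOver L v => (w.1.adicCompletionIntegers L).toSubring.toSubmonoid)).units.prod (⊤ : Subgroup ↥(normOneUnits (conjLocal L (IsCMField.complexConj L) v)))) : Subgroup ((UnitaryGroup.LocalRing L v)ˣ × ↥(normOneUnits (conjLocal L (IsCMField.complexConj L) v)))) : Set ((UnitaryGroup.LocalRing L v)ˣ × ↥(normOneUnits (conjLocal L (IsCMField.complexConj L) v))))).indicator (fun m => (((F0P3cStCharTSTorusDefs.pairChar L v (cond j (conjInvChar (conjLocal L (IsCMField.complexConj L) v) χ.1, χ.2) χ)) m₀ : ℂˣ) : ℂ) * ((((F0P3cStCharTSTorusDefs.pairChar L v (cond j (conjInvChar (conjLocal L (IsCMField.complexConj L) v) χ.1, χ.2) χ)) m)⁻¹ : ℂˣ) : ℂ)) m) + ((m₀ • ((((Submonoid.pi Set.univ (fun w : PlacesOver L v => (w.1.adicCompletionIntegers L).toSubring.toSubmonoid)).units.prod (⊤ : Subgroup ↥(normOneUnits (conjLocal L (IsCMField.complexConj L) v)))) : Subgroup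 ((UnitaryGroup.LocalRing L v)ˣ × ↥(normOneUnits (conjLocal L (IsCMField.complexConj L) v)))) : Set ((UnitaryGroup.LocalRing L v)ˣ × ↥(normOneUnits (conjLocal L (IsCMField.complexConj L) v))))).indicator (fun m => (((F0P3cStCharTSTorusDefs.pairChar L v (cond j (conjInvChar (conjLocal L (IsCMField.complexConj L) v) χ.1, χ.2) χ)) m₀ : ℂˣ) : ℂ) * ((((F0P3cStCharTSTorusDefs.pairChar L v (cond j (conjInvChar (conjLocal L (IsCMField.complexConj L) v) χ.1, χ.2) χ)) m)⁻¹ : ℂˣ) : ℂ)) ((Units.map ((conjLocal L (IsCMField.complexConj L) v : UnitaryGroup.LocalRing L v →+* UnitaryGroup.LocalRing L v) : UnitaryGroup.LocalRing L v →* UnitaryGroup.LocalRing L v) m.1)⁻¹, m.2))) :=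
  shf_of_surj L v hns (F0P3cStCharTSTorusDefs.torusTransform L v mQv μM) (F0P3cStCharTSTorusDefs.hyperbolicSet L v) (F0P3cStCharTSTorusDefs.pairChar L v)
    (F0P3cStCharTSTorusDefs.pairChar_apply L v) hsurj

end Summit.HodgeConjecture.HodgeConjecture.Cruxes.H413.F0P3cStCharTSShfOfSurj

end
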